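import Mathlib.Analysis.Convex.Integral
import Mathlib.Analysis.Normed.Operator.Compact.Basic
import Literature.Analysis.OperatorTheory.RieszProjectionDichotomy
import HarnessLib

/-!
# The Riesz projections of `m` and `s` over a common circle differ by a compact operator when
  `m − s` is compact

Analysis/OperatorTheory proofs-layer file (theorems only, no definitions, no named facts),
continuing `RieszProjectionDichotomy.lean`. If `m − s` is a compact operator on a complex Banach
space and the circle `|z − c| = r` lies in `ρ(m) ∩ ρ(s)`, then by the second resolvent identity
`R_m(z) − R_s(z) = R_m(z)(m − s)R_s(z)` the integrand of `P_r(m) − P_r(s) = (2πi)⁻¹∮ (R_m − R_s)`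
is compact-operator valued, and a Bochner integral of a function with values in the closed
subspace of compact operators is compact (`circleIntegral_mem_of_convex_closed`, via Mathlib's
`Convex.set_average_mem`). This is the step "`P` is compact, hence finite-dimensional" in the
Riesz splitting of a quasi-compact operator `m = s + k` (for which `P_r(s) = 1`, so that
`1 − P_r(m)` is compact): Kato 1966, III-§6.7 Thm. 6.26 / IV-§5.6.

## References

* T. Kato, *Perturbation Theory for Linear Operators*, Springer 1966, III-§6.4, III-§6.7
  Thm. 6.26, IV-§5.6 Thm. 5.35. [Kato1966]
-/

noncomputable section

open _root_.Complex _root_.MeasureTheory _root_.Metric _root_.Set _root_.Filter _root_.Topology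

namespace Literature.Analysis.OperatorTheory

section Integral

variable {F : Type*} [NormedAddCommGroup F] [NormedSpace ℂ F] [CompleteSpace F]

/-- **A circle integral of a function with values in a closed convex cone-like set stays in it**:
if `S ⊆ F` is convex, closed, stable under complex scalar multiplication, and `f z ∈ S` on the
circle `|z − c| = R` (`R > 0`) with `f` circle integrable, then `∮_{C(c,R)} f ∈ S` (the integral
over `[0, 2π]` is `2π` times an average, and averages of `S`-valued functions lie in `S`).
[folklore] -/
theorem circleIntegral_mem_of_convex_closed {S : Set F} (hconv : Convex ℝ S) (hcl : IsClosed S)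
    (hsmul : ∀ (c : ℂ) (x : F), x ∈ S → c • x ∈ S) (hsmulr : ∀ (c : ℝ) (x : F), x ∈ S → c • x ∈ S)
    {f : ℂ → F} {c : ℂ} {R : ℝ} (hR : 0 < R) (hf : CircleIntegrable f c R)
    (hmem : ∀ z ∈ sphere c R, f z ∈ S) : (∮ z in C(c, R), f z) ∈ S := by
  have hint : IntegrableOn (fun θ : ℝ => deriv (circleMap c R) θ • f (circleMap c R θ))
      (Ioc 0 (2 * Real.pi)) volume := ((circleIntegrable_iff R).1 hf).1
  rw [circleIntegral, intervalIntegral.integral_of_le Real.two_pi_pos.le,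
    ← measure_smul_setAverage _ measure_Ioc_lt_top.ne]
  refine hsmulr _ _ (hconv.set_average_mem hcl ?_ measure_Ioc_lt_top.ne ?_ hint)
  · rw [Real.volume_Ioc, sub_zero]; simp [Real.pi_pos]
  · refine ae_restrict_of_forall_mem measurableSet_Ioc fun θ _ => ?_
    exact hsmul _ _ (hmem _ (circleMap_mem_sphere c hR.le θ))

end Integral

section Operator

variable {X : Type*} [NormedAddCommGroup X] [NormedSpace ℂ X] [CompleteSpace X]

/-- **A circle integral of compact operators is compact** (the compact operators form a closed
subspace of `X →L[ℂ] X`, Mathlib `isClosed_setOf_isCompactOperator`). [folklore] -/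
theorem isCompactOperator_circleIntegral {f : ℂ → (X →L[ℂ] X)} {c : ℂ} {R : ℝ} (hR : 0 < R)
    (hf : CircleIntegrable f c R) (hmem : ∀ z ∈ sphere c R, IsCompactOperator (f z)) :
    IsCompactOperator (⇑(∮ z in C(c, R), f z)) := by
  let S : Submodule ℂ (X →L[ℂ] X) := compactOperator (RingHom.id ℂ) X X
  have hS : (∮ z in C(c, R), f z) ∈ (S : Set (X →L[ℂ] X)) :=
    circleIntegral_mem_of_convex_closed (S.restrictScalars ℝ).convex isClosed_setOf_isCompactOperator
      (fun c x hx => S.smul_mem c hx) (fun c x hx => by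
        have h := S.smul_mem (c : ℂ) hx; rwa [Complex.coe_smul] at h) hR hf hmem
  exact hS

/-- **`P_r(m) − P_r(s)` is compact when `m − s` is.** For bounded operators `m, s` on a complex
Banach space with `m − s` compact and a circle `|z − c| = r` (`r > 0`) in `ρ(m) ∩ ρ(s)`, the
difference of the Riesz projections `rieszProjection m c r − rieszProjection s c r` is a compact
operator (second resolvent identity `R_m − R_s = R_m (m − s) R_s` under the integral; Kato
IV-§5.6, proof of Thm. 5.35, and III-§6.7). [cite: Kato1966, IV-§5.6 Thm. 5.35] -/
theorem isCompactOperator_rieszProjection_sub {m s : X →L[ℂ] X}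
    (hk : IsCompactOperator (m - s : X →L[ℂ] X)) {c : ℂ} {r : ℝ} (hr : 0 < r)
    (hsm : sphere c r ⊆ resolventSet ℂ m) (hss : sphere c r ⊆ resolventSet ℂ s) :
    IsCompactOperator (⇑(rieszProjection m c r - rieszProjection s c r)) := by
  have hRm : ContinuousOn (fun z : ℂ => resolvent m z) (sphere c r) :=
    (continuousOn_resolvent m).mono hsm
  have hRs : ContinuousOn (fun z : ℂ => resolvent s z) (sphere c r) :=
    (continuousOn_resolvent s).mono hss
  have heq : rieszProjection m c r - rieszProjection s c r =
      (2 * Real.pi * I : ℂ)⁻¹ • ∮ z in C(c, r), (resolvent m z - resolvent s z) := by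
    rw [rieszProjection_def, rieszProjection_def, ← smul_sub,
      circleIntegral.integral_sub (hRm.circleIntegrable hr.le) (hRs.circleIntegrable hr.le)]
  have hsub : ContinuousOn (fun z : ℂ => resolvent m z - resolvent s z) (sphere c r) :=
    hRm.sub hRs
  rw [heq]
  refine (isCompactOperator_circleIntegral hr (hsub.circleIntegrable hr.le)
    fun z hz => ?_).smul _
  rw [resolvent_sub_resolvent_eq_mul (hsm hz) (hss hz)]
  exact (hk.comp_clm (resolvent s z)).clm_comp (resolvent m z)

end Operator

end Literature.Analysis.OperatorTheory
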